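import Summits.QuantumFields.YangMills.Theorems.BalabanLadderNTReferenceThreePointNoE2
import Summits.QuantumFields.YangMills.Theorems.BalabanLadderIRAfOnsetLatticeAF
import Summits.QuantumFields.YangMills.Theorems.BalabanLadderIRAfOnsetHalfSpace
import HarnessLib

/-!
# Crux `NT` (stmt-QuantumFields-19353): the MARGINS of the registered package `RefPkgT` are β-UNIFORM NUMBERS, I —
# support geometry of the witnesses and the two-point margin

Helper file (`--supports stmt-QuantumFields-19353`) of the fleet lead prover of crux `NT` (unit `ym-spine-19353-p1`,
g11), hypothesis-free; first of three (`…NTReferenceMargins` / `…NTReferenceMarginsThreePoint` /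
`…NTReferenceMarginsPackage`).  The registered stub `stub_refpkgT : RefPkgT` (skeleton v4T 4297522f58b4c3a5; tree twin:
the hypothesis of `Reference.nt_of_torusReferencePackage`) asks, beside the three exterior-oscillation ceilings
E1/E2/E3-osc with constants `C₁, C₂, C₃` and the collar `κ`, two floors WITH MARGIN on one torus `L₀(β)` per coupling:
  clause 4: `ε + M₂(β) ≤ Q2 G r β (L₀ β) (a β) (θv) v`,
    `M₂(β) = 2·(C₁(a/κ)⁴ Σ_x|θv(a x)|)·(C₁(a/κ)⁴ Σ_y|v(a y)|) + C₂(a/κ)⁴ Σ_{x,y} |θv(a x)||v(a y)| / (1 + ‖y − x‖)⁴`,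
  clause 5: `ε + M₃(β) ≤ |Q3 G r β (L₀ β) (a β) f g h|`, `M₃(β)` the triple sum against `2(k w_zy + k w_zx + k w_yx + k³) + ω₃`
(`a = a β`, sums over `box 4 (L₀ β)`).  The ENGINE-TARGET v4 memo (g4) asserted in prose that these margins are
«a-INDEPENDENT to leading order».  The series proves β-UNIFORM bounds, with constants, for EVERY admissible witness;
this file:

* §1 support geometry: `exists_timeGap_of_tsupport_subset` (a test function supported at positive times inside a ball
  has a TIME GAP `δ > 0`: `v y ≠ 0 → δ ≤ y 0`), `two_mul_timeGap_le` (on the lattice of unit `a`, a point charged by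
  `θv` and a point charged by `v` are `≥ 2δ/a` apart), `sep_le_mul_norm` (pairwise-separated supports: charged points
  `≥ δ/a` apart), and the kernel bounds `inv_one_add_norm_pow_four_le[_of_sep]`, `inv_one_add_min_pow_eight_le`;
* §2 **`refMargin₂_le`** — for `0 < a ≤ 1` and EVERY finite `Λ ⊆ ℤ⁴`:
  **`M₂ ≤ K_θ K_v · (2 C₁²/κ⁸ + C₂/(κ⁴ (2δ)⁴))`**, where `Σ_{x∈Λ} |θv(a x)| ≤ K_θ/a⁴`, `Σ_{y∈Λ}|v(a y)| ≤ K_v/a⁴` are the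
  lattice ℓ¹-envelopes of the tree (`AfOnset.exists_sum_abs_schwartz_lattice_le_div_min`) — the unit `a` CANCELS EXACTLY
  (`(a/κ)⁴ · a⁻⁴` per smearing; `(a/κ)⁴ (a/2δ)⁴ a⁻⁸` for the pair kernel); `exists_timeGap_envelopes` (the data `δ, K_θ, K_v`
  exist for every admissible witness), `exists_refMargin₂_le` (ONE number bounds the margin at every unit `≤ 1` and box).

NUMBERS (sizing of the registered stub; owner's / LEAD's pen, nothing registered).  The clause-4 witness must clear
`ε > K_θ K_v (2C₁²κ⁻⁸ + C₂ κ⁻⁴ (2δ)⁻⁴)`; with `K ≈ ‖v‖₁` (the envelopes tend to the `L¹` norms as `a → 0`) and the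
physical two-point function of `tr F²` at separation `2δ` of order `g(2δ)⁴/(2δ)⁸`, the collar must satisfy
`κ⁸ ≳ 2C₁²(2δ)⁸/g⁴` and `κ⁴ ≳ C₂(2δ)⁴/g⁴` — i.e. `κ/2δ ≳ C₂^{1/4}/g(2δ)`, growing only logarithmically as the witness
shrinks (asymptotic freedom), while `2(σ+κ) < ℓ` caps `κ` by the femto range: the registered package is self-consistent
iff the engine's `ℓ` exceeds `≈ 2δ(1 + C₂^{1/4}/g(2δ))`.

HONEST FRAMING.  Elementary real analysis over tree objects (Schwartz envelopes, support geometry); the floors and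
ceilings themselves are engine-grade OPEN (PerturbativeInvisibility); not a floor, not AF, not NT, not the seam, not the
gap; not Clay.
-/

set_option autoImplicit false

noncomputable section

open scoped SchwartzMap
open MeasureTheory Filter Topology Finset
open Literature.MathematicalPhysics.QuantumFieldTheory Literature.MathematicalPhysics.QuantumLattice
open Literature.Probability.LatticeModels
open Summit.QuantumFields.YangMills.Cruxes.OSLegsFromFemtoAndGap.DlrCollarTransfer
open Summit.QuantumFields.YangMills.Cruxes.IR.AfOnset (exists_sum_abs_schwartz_lattice_le_div_min
  thetaTest_apply_eq_zero_of_tsupport_subset apply_eq_zero_of_tsupport_subset)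

namespace Summit.QuantumFields.YangMills.Cruxes.NT.Reference

/-! ## §1 Support geometry of the witnesses -/

section Geometry

/-- **Time gap of a positive-time witness.**  A test function supported at positive times inside a ball vanishes below a
positive height: `∃ δ > 0, v y ≠ 0 → δ ≤ y 0` (compactness of the support). [folklore] -/
theorem exists_timeGap_of_tsupport_subset {v : 𝓢(EuclideanSpace ℝ (Fin 4), ℝ)} {σ : ℝ}
    (hv : tsupport (v : EuclideanSpace ℝ (Fin 4) → ℝ) ⊆ {y | 0 < y 0})
    (hvσ : tsupport (v : EuclideanSpace ℝ (Fin 4) → ℝ) ⊆ Metric.closedBall 0 σ) :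
    ∃ δ : ℝ, 0 < δ ∧ ∀ y : EuclideanSpace ℝ (Fin 4), v y ≠ 0 → δ ≤ y 0 := by
  have hK : IsCompact (tsupport (v : EuclideanSpace ℝ (Fin 4) → ℝ)) :=
    (isCompact_closedBall (0 : EuclideanSpace ℝ (Fin 4)) σ).of_isClosed_subset (isClosed_tsupport _) hvσ
  have hcont : Continuous fun y : EuclideanSpace ℝ (Fin 4) => y 0 :=
    (EuclideanSpace.proj (𝕜 := ℝ) (0 : Fin 4)).continuous
  by_cases hne : (tsupport (v : EuclideanSpace ℝ (Fin 4) → ℝ)).Nonempty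
  · obtain ⟨y₀, hy₀, hmin⟩ := hK.exists_isMinOn hne hcont.continuousOn
    refine ⟨y₀ 0, hv hy₀, fun y hy => ?_⟩
    exact hmin (subset_tsupport _ (Function.mem_support.2 hy))
  · refine ⟨1, one_pos, fun y hy => ?_⟩
    exact (hne ⟨y, subset_tsupport _ (Function.mem_support.2 hy)⟩).elim

/-- The time coordinate of a lattice point of unit `a`: `(a • siteToE x) 0 = a · x 0`. [folklore] -/
theorem smul_siteToE_apply_zero (a : ℝ) (x : Fin 4 → ℤ) : (a • siteToE x) 0 = a * (x 0 : ℝ) := by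
  simp [siteToE_apply]

/-- The time separation is at most the Euclidean separation: `(y 0 − x 0 : ℝ) ≤ ‖siteToE (y − x)‖`. [folklore] -/
theorem sub_apply_zero_le_norm_siteToE (x y : Fin 4 → ℤ) : ((y 0 : ℝ) - (x 0 : ℝ)) ≤ ‖siteToE (y - x)‖ := by
  have h := PiLp.norm_apply_le (siteToE (y - x)) 0
  rw [siteToE_apply, Pi.sub_apply, Int.cast_sub, Real.norm_eq_abs] at h
  exact (le_abs_self _).trans h

/-- **Reflected and direct witness are `2δ/a` apart on the lattice.**  If `v` has time gap `δ` (`v y ≠ 0 → δ ≤ y 0`), then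
`θv (a x) ≠ 0` and `v (a y) ≠ 0` (`a > 0`) force `2δ ≤ a · ‖siteToE (y − x)‖`. [folklore] -/
theorem two_mul_timeGap_le {v : 𝓢(EuclideanSpace ℝ (Fin 4), ℝ)} {δ : ℝ}
    (hvδ : ∀ y : EuclideanSpace ℝ (Fin 4), v y ≠ 0 → δ ≤ y 0) {a : ℝ} (ha : 0 < a) {x y : Fin 4 → ℤ}
    (hx : thetaTest 4 v (a • siteToE x) ≠ 0) (hy : v (a • siteToE y) ≠ 0) :
    2 * δ ≤ a * ‖siteToE (y - x)‖ := by
  rw [thetaTest_apply] at hx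
  have h1 := hvδ _ hx
  have h0 : (timeReflection 4 (a • siteToE x)) 0 = -((a • siteToE x) 0) := by simp
  rw [h0, smul_siteToE_apply_zero] at h1
  have h2 := hvδ _ hy
  rw [smul_siteToE_apply_zero] at h2
  have h3 := sub_apply_zero_le_norm_siteToE x y
  nlinarith [mul_le_mul_of_nonneg_left h3 ha.le]

/-- Consequently `1/(1 + ‖siteToE (y − x)‖)⁴ ≤ (a/(2δ))⁴` for such pairs (`0 < δ`). [folklore] -/
theorem inv_one_add_norm_pow_four_le {v : 𝓢(EuclideanSpace ℝ (Fin 4), ℝ)} {δ : ℝ} (hδ : 0 < δ)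
    (hvδ : ∀ y : EuclideanSpace ℝ (Fin 4), v y ≠ 0 → δ ≤ y 0) {a : ℝ} (ha : 0 < a) {x y : Fin 4 → ℤ}
    (hx : thetaTest 4 v (a • siteToE x) ≠ 0) (hy : v (a • siteToE y) ≠ 0) :
    1 / (1 + ‖siteToE (y - x)‖) ^ 4 ≤ (a / (2 * δ)) ^ 4 := by
  have h := two_mul_timeGap_le hvδ ha hx hy
  have h2δ : 0 < 2 * δ := by positivity
  have hn : 2 * δ / a ≤ 1 + ‖siteToE (y - x)‖ := by
    rw [div_le_iff₀ ha]; nlinarith [norm_nonneg (siteToE (y - x))]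
  have hpos : 0 < 1 + ‖siteToE (y - x)‖ := by positivity
  rw [div_le_iff₀ (pow_pos hpos 4), ← mul_pow]
  have h3 : 1 ≤ a / (2 * δ) * (1 + ‖siteToE (y - x)‖) := by
    rw [div_mul_eq_mul_div, le_div_iff₀ h2δ, one_mul]
    calc 2 * δ = a * (2 * δ / a) := by field_simp
      _ ≤ a * (1 + ‖siteToE (y - x)‖) := mul_le_mul_of_nonneg_left hn ha.le
  exact one_le_pow₀ h3

/-- **Separated supports on the lattice.**  If `f p ≠ 0 → g q ≠ 0 → δ ≤ ‖p − q‖`, then `f (a x) ≠ 0`, `g (a y) ≠ 0`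
(`a > 0`) force `δ ≤ a · ‖siteToE (y − x)‖` (and the same with `x, y` exchanged inside the norm). [folklore] -/
theorem sep_le_mul_norm {f g : 𝓢(EuclideanSpace ℝ (Fin 4), ℝ)} {δ : ℝ}
    (hfg : ∀ p q : EuclideanSpace ℝ (Fin 4), f p ≠ 0 → g q ≠ 0 → δ ≤ ‖p - q‖) {a : ℝ} (ha : 0 < a)
    {x y : Fin 4 → ℤ} (hx : f (a • siteToE x) ≠ 0) (hy : g (a • siteToE y) ≠ 0) :
    δ ≤ a * ‖siteToE (y - x)‖ ∧ δ ≤ a * ‖siteToE (x - y)‖ := by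
  have h := hfg _ _ hx hy
  have e1 : ‖a • siteToE x - a • siteToE y‖ = a * ‖siteToE (x - y)‖ := norm_smul_siteToE_sub a ha y x
  have e2 : ‖siteToE (y - x)‖ = ‖siteToE (x - y)‖ := by
    rw [← norm_neg, show -siteToE (y - x) = siteToE (x - y) by ext i; simp [siteToE_apply]]
  rw [e1] at h
  exact ⟨by rw [e2]; exact h, h⟩

/-- Consequently `1/(1 + ‖siteToE (y − x)‖)⁴ ≤ (a/δ)⁴` for such pairs (`0 < δ`). [folklore] -/
theorem inv_one_add_norm_pow_four_le_of_sep {f g : 𝓢(EuclideanSpace ℝ (Fin 4), ℝ)} {δ : ℝ} (hδ : 0 < δ)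
    (hfg : ∀ p q : EuclideanSpace ℝ (Fin 4), f p ≠ 0 → g q ≠ 0 → δ ≤ ‖p - q‖) {a : ℝ} (ha : 0 < a)
    {x y : Fin 4 → ℤ} (hx : f (a • siteToE x) ≠ 0) (hy : g (a • siteToE y) ≠ 0) :
    1 / (1 + ‖siteToE (y - x)‖) ^ 4 ≤ (a / δ) ^ 4 ∧ 1 / (1 + ‖siteToE (x - y)‖) ^ 4 ≤ (a / δ) ^ 4 := by
  obtain ⟨h1, h2⟩ := sep_le_mul_norm hfg ha hx hy
  have key : ∀ t : ℝ, 0 ≤ t → δ ≤ a * t → 1 / (1 + t) ^ 4 ≤ (a / δ) ^ 4 := by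
    intro t ht hδt
    have hpos : 0 < 1 + t := by positivity
    rw [div_le_iff₀ (pow_pos hpos 4), ← mul_pow]
    refine one_le_pow₀ ?_
    rw [div_mul_eq_mul_div, le_div_iff₀ hδ, one_mul]
    nlinarith
  exact ⟨key _ (norm_nonneg _) h1, key _ (norm_nonneg _) h2⟩

/-- The same for the eighth power of the minimal pairwise separation of a charged triple. [folklore] -/
theorem inv_one_add_min_pow_eight_le {t₁ t₂ t₃ δ a : ℝ} (hδ : 0 < δ) (ha : 0 < a) (h0₁ : 0 ≤ t₁) (h0₂ : 0 ≤ t₂)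
    (h0₃ : 0 ≤ t₃) (h₁ : δ ≤ a * t₁) (h₂ : δ ≤ a * t₂) (h₃ : δ ≤ a * t₃) :
    1 / (1 + min (min t₁ t₂) t₃) ^ 8 ≤ (a / δ) ^ 8 := by
  have hm : δ ≤ a * min (min t₁ t₂) t₃ := by
    rcases min_choice (min t₁ t₂) t₃ with h | h <;> rw [h]
    · rcases min_choice t₁ t₂ with h' | h' <;> rw [h'] <;> assumption
    · exact h₃
  have hm0 : 0 ≤ min (min t₁ t₂) t₃ := le_min (le_min h0₁ h0₂) h0₃
  have hpos : 0 < 1 + min (min t₁ t₂) t₃ := by positivity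
  rw [div_le_iff₀ (pow_pos hpos 8), ← mul_pow]
  refine one_le_pow₀ ?_
  rw [div_mul_eq_mul_div, le_div_iff₀ hδ, one_mul]
  nlinarith

end Geometry

/-! ## §2 The two-point margin is a β-uniform number -/

section Margin2

/-- **Clause-4 margin bound.**  Let `v` have time gap `δ > 0` and lattice ℓ¹-envelopes `Σ_{x∈Λ}|θv(a x)| ≤ K_θ/a⁴`,
`Σ_{y∈Λ}|v(a y)| ≤ K_v/a⁴` (`0 < a ≤ 1`, every finite `Λ`); let `C₂ ≥ 0`, `κ > 0` (`C₁` any real).  Then for every unit `0 < a ≤ 1`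
and every finite `Λ ⊆ ℤ⁴` the clause-4 margin of `RefPkgT` is at most `K_θ K_v (2C₁²/κ⁸ + C₂/(κ⁴(2δ)⁴))` — independent of
the unit and of the box. [folklore] -/
theorem refMargin₂_le {v : 𝓢(EuclideanSpace ℝ (Fin 4), ℝ)} {δ : ℝ} (hδ : 0 < δ)
    (hvδ : ∀ y : EuclideanSpace ℝ (Fin 4), v y ≠ 0 → δ ≤ y 0) {Kθ Kv : ℝ} (hKθ0 : 0 ≤ Kθ)
    (hKθ : ∀ a : ℝ, 0 < a → a ≤ 1 → ∀ Λ : Finset (Fin 4 → ℤ),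
      ∑ x ∈ Λ, |thetaTest 4 v (a • siteToE x)| ≤ Kθ / a ^ 4)
    (hKv : ∀ a : ℝ, 0 < a → a ≤ 1 → ∀ Λ : Finset (Fin 4 → ℤ), ∑ y ∈ Λ, |v (a • siteToE y)| ≤ Kv / a ^ 4)
    {C₁ C₂ κ : ℝ} (hC₂ : 0 ≤ C₂) (hκ : 0 < κ) {a : ℝ} (ha : 0 < a) (ha1 : a ≤ 1)
    (Λ : Finset (Fin 4 → ℤ)) :
    2 * (C₁ * (a / κ) ^ 4 * ∑ x ∈ Λ, |thetaTest 4 v (a • siteToE x)|) *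
          (C₁ * (a / κ) ^ 4 * ∑ y ∈ Λ, |v (a • siteToE y)|) +
        C₂ * (a / κ) ^ 4 * ∑ x ∈ Λ, ∑ y ∈ Λ,
          |thetaTest 4 v (a • siteToE x)| * |v (a • siteToE y)| / (1 + ‖siteToE (y - x)‖) ^ 4 ≤
      Kθ * Kv * (2 * C₁ ^ 2 / κ ^ 8 + C₂ / (κ ^ 4 * (2 * δ) ^ 4)) := by
  set Sθ := ∑ x ∈ Λ, |thetaTest 4 v (a • siteToE x)| with hSθ
  set Sv := ∑ y ∈ Λ, |v (a • siteToE y)| with hSv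
  have hSθ0 : 0 ≤ Sθ := sum_nonneg fun _ _ => abs_nonneg _
  have hSv0 : 0 ≤ Sv := sum_nonneg fun _ _ => abs_nonneg _
  have hSθle : Sθ ≤ Kθ / a ^ 4 := hKθ a ha ha1 Λ
  have hSvle : Sv ≤ Kv / a ^ 4 := hKv a ha ha1 Λ
  have ha4 : 0 < a ^ 4 := pow_pos ha 4
  have hKv0 : 0 ≤ Kv := by
    have := hSv0.trans hSvle
    rwa [le_div_iff₀ ha4, zero_mul] at this
  -- the product of the envelopes: `Sθ · Sv ≤ Kθ Kv / a⁸`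
  have hprod : Sθ * Sv ≤ Kθ / a ^ 4 * (Kv / a ^ 4) :=
    mul_le_mul hSθle hSvle hSv0 (div_nonneg hKθ0 ha4.le)
  -- term A
  have hA : 2 * (C₁ * (a / κ) ^ 4 * Sθ) * (C₁ * (a / κ) ^ 4 * Sv) ≤ Kθ * Kv * (2 * C₁ ^ 2 / κ ^ 8) := by
    have e1 : 2 * (C₁ * (a / κ) ^ 4 * Sθ) * (C₁ * (a / κ) ^ 4 * Sv) = 2 * C₁ ^ 2 * (a / κ) ^ 8 * (Sθ * Sv) := by ring
    have e2 : Kθ * Kv * (2 * C₁ ^ 2 / κ ^ 8) = 2 * C₁ ^ 2 * (a / κ) ^ 8 * (Kθ / a ^ 4 * (Kv / a ^ 4)) := by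
      field_simp
    rw [e1, e2]
    exact mul_le_mul_of_nonneg_left hprod (by positivity)
  -- term B: the pair kernel is `≤ (a/2δ)⁴` on charged pairs
  have hB1 : ∑ x ∈ Λ, ∑ y ∈ Λ, |thetaTest 4 v (a • siteToE x)| * |v (a • siteToE y)| / (1 + ‖siteToE (y - x)‖) ^ 4 ≤
      ∑ x ∈ Λ, ∑ y ∈ Λ, |thetaTest 4 v (a • siteToE x)| * |v (a • siteToE y)| * (a / (2 * δ)) ^ 4 := by
    refine sum_le_sum fun x _ => sum_le_sum fun y _ => ?_
    by_cases hx : thetaTest 4 v (a • siteToE x) = 0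
    · rw [hx, abs_zero, zero_mul, zero_div, zero_mul]
    by_cases hy : v (a • siteToE y) = 0
    · rw [hy, abs_zero, mul_zero, zero_div, zero_mul]
    have hk := inv_one_add_norm_pow_four_le hδ hvδ ha hx hy
    rw [div_eq_mul_one_div]
    exact mul_le_mul_of_nonneg_left hk (by positivity)
  have hB2 : ∑ x ∈ Λ, ∑ y ∈ Λ, |thetaTest 4 v (a • siteToE x)| * |v (a • siteToE y)| * (a / (2 * δ)) ^ 4 =
      Sθ * Sv * (a / (2 * δ)) ^ 4 := by
    rw [hSθ, hSv, sum_mul_sum, sum_mul]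
    refine sum_congr rfl fun x _ => ?_
    rw [sum_mul]
  have hB : C₂ * (a / κ) ^ 4 * ∑ x ∈ Λ, ∑ y ∈ Λ,
        |thetaTest 4 v (a • siteToE x)| * |v (a • siteToE y)| / (1 + ‖siteToE (y - x)‖) ^ 4 ≤
      Kθ * Kv * (C₂ / (κ ^ 4 * (2 * δ) ^ 4)) := by
    have h1 : C₂ * (a / κ) ^ 4 * ∑ x ∈ Λ, ∑ y ∈ Λ,
          |thetaTest 4 v (a • siteToE x)| * |v (a • siteToE y)| / (1 + ‖siteToE (y - x)‖) ^ 4 ≤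
        C₂ * (a / κ) ^ 4 * (Sθ * Sv * (a / (2 * δ)) ^ 4) := by
      rw [← hB2]; exact mul_le_mul_of_nonneg_left hB1 (by positivity)
    refine h1.trans ?_
    have e1 : C₂ * (a / κ) ^ 4 * (Sθ * Sv * (a / (2 * δ)) ^ 4) = C₂ * (a / κ) ^ 4 * (a / (2 * δ)) ^ 4 * (Sθ * Sv) := by
      ring
    have e2 : Kθ * Kv * (C₂ / (κ ^ 4 * (2 * δ) ^ 4)) =
        C₂ * (a / κ) ^ 4 * (a / (2 * δ)) ^ 4 * (Kθ / a ^ 4 * (Kv / a ^ 4)) := by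
      field_simp
    rw [e1, e2]
    exact mul_le_mul_of_nonneg_left hprod (by positivity)
  rw [mul_add]
  exact add_le_add hA hB

/-- **The data exist for every admissible clause-4 witness**: a test function supported at positive times inside a ball
has a time gap `δ > 0` and lattice ℓ¹-envelopes `K_θ, K_v ≥ 0` as required by `refMargin₂_le`. [folklore] -/
theorem exists_timeGap_envelopes {v : 𝓢(EuclideanSpace ℝ (Fin 4), ℝ)} {σ : ℝ}
    (hv : tsupport (v : EuclideanSpace ℝ (Fin 4) → ℝ) ⊆ {y | 0 < y 0})
    (hvσ : tsupport (v : EuclideanSpace ℝ (Fin 4) → ℝ) ⊆ Metric.closedBall 0 σ) :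
    ∃ δ Kθ Kv : ℝ, 0 < δ ∧ (∀ y : EuclideanSpace ℝ (Fin 4), v y ≠ 0 → δ ≤ y 0) ∧ 0 ≤ Kθ ∧ 0 ≤ Kv ∧
      (∀ a : ℝ, 0 < a → a ≤ 1 → ∀ Λ : Finset (Fin 4 → ℤ),
        ∑ x ∈ Λ, |thetaTest 4 v (a • siteToE x)| ≤ Kθ / a ^ 4) ∧
      (∀ a : ℝ, 0 < a → a ≤ 1 → ∀ Λ : Finset (Fin 4 → ℤ), ∑ y ∈ Λ, |v (a • siteToE y)| ≤ Kv / a ^ 4) := by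
  obtain ⟨δ, hδ, hvδ⟩ := exists_timeGap_of_tsupport_subset hv hvσ
  obtain ⟨Kθ, hKθ0, hKθ⟩ := exists_sum_abs_schwartz_lattice_le_div_min (thetaTest 4 v)
  obtain ⟨Kv, hKv0, hKv⟩ := exists_sum_abs_schwartz_lattice_le_div_min v
  refine ⟨δ, Kθ, Kv, hδ, hvδ, hKθ0, hKv0, fun a ha ha1 Λ => ?_, fun a ha ha1 Λ => ?_⟩
  · have h := hKθ a ha Λ; rwa [min_eq_left ha1] at h
  · have h := hKv a ha Λ; rwa [min_eq_left ha1] at h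

/-- **Existential form**: for every admissible clause-4 witness and constants `C₂ ≥ 0`, `κ > 0`, `C₁` there is ONE number
`M ≥ 0` bounding the clause-4 margin at every unit `0 < a ≤ 1` and every finite box. [folklore] -/
theorem exists_refMargin₂_le {v : 𝓢(EuclideanSpace ℝ (Fin 4), ℝ)} {σ : ℝ}
    (hv : tsupport (v : EuclideanSpace ℝ (Fin 4) → ℝ) ⊆ {y | 0 < y 0})
    (hvσ : tsupport (v : EuclideanSpace ℝ (Fin 4) → ℝ) ⊆ Metric.closedBall 0 σ)
    {C₁ C₂ κ : ℝ} (hC₂ : 0 ≤ C₂) (hκ : 0 < κ) :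
    ∃ M : ℝ, 0 ≤ M ∧ ∀ a : ℝ, 0 < a → a ≤ 1 → ∀ Λ : Finset (Fin 4 → ℤ),
      2 * (C₁ * (a / κ) ^ 4 * ∑ x ∈ Λ, |thetaTest 4 v (a • siteToE x)|) *
            (C₁ * (a / κ) ^ 4 * ∑ y ∈ Λ, |v (a • siteToE y)|) +
          C₂ * (a / κ) ^ 4 * ∑ x ∈ Λ, ∑ y ∈ Λ,
            |thetaTest 4 v (a • siteToE x)| * |v (a • siteToE y)| / (1 + ‖siteToE (y - x)‖) ^ 4 ≤ M := by
  obtain ⟨δ, Kθ, Kv, hδ, hvδ, hKθ0, hKv0, hKθ, hKv⟩ := exists_timeGap_envelopes hv hvσ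
  exact ⟨Kθ * Kv * (2 * C₁ ^ 2 / κ ^ 8 + C₂ / (κ ^ 4 * (2 * δ) ^ 4)), by positivity,
    fun a ha ha1 Λ => refMargin₂_le (C₁ := C₁) hδ hvδ hKθ0 hKθ hKv hC₂ hκ ha ha1 Λ⟩

end Margin2

end Summit.QuantumFields.YangMills.Cruxes.NT.Reference

end
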